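import Literature.Algebra.Homology.GroupCohomologyAdicNakayama
import Mathlib.RepresentationTheory.Homological.GroupCohomology.LongExactSequence
import HarnessLib

/-!
# `Hⁿ(G, A)` is finitely generated when `Hⁿ(G, A/ϖ)` is finite (complete lattices)

Topic `Algebra/Homology`; namespace `Literature.Algebra.Homology`; theorems only, continuing
`GroupCohomologyAdicNakayama`.

For a representation `A` of a group `G` over `k`, `ϖ ∈ k` acting injectively on `V = A.V`
(`ϖ`-torsion-free coefficients), the short exact sequence `0 → A →(ϖ·) A → A/ϖA → 0`
(`Rep.quotient`, `Rep.mkQ`; `smul_shortExact`) and Mathlib's long exact sequence of group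
cohomology (`groupCohomology.mapShortComplex₂_exact`) give
**`ker (Hⁿ(G, A) → Hⁿ(G, A/ϖA)) = ϖ Hⁿ(G, A)`** (`ker_map_mkQ_le_smul_top`; the map `Hⁿ(ϖ · 𝟙)`
is multiplication by `ϖ`, `map_smul_id_apply`), hence `Hⁿ(G, A)/ϖ ↪ Hⁿ(G, A/ϖA)`; so if
`Hⁿ(G, A/ϖA)` is FINITE then `Hⁿ(G, A)/ϖ` is finite (`finite_quotient_smul_top_of_finite`) and, for
`ϖ`-adically complete `k` and complete separated `V`, **`Hⁿ(G, A)` is a finitely generated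
`k`-module** (`moduleFinite_of_finite_cohomology_quotient`, by the adic Nakayama lemma on
cochains of `GroupCohomologyAdicNakayama`) — with NO finiteness hypothesis on `G`.  This is the
passage from the finiteness of cohomology with finite coefficients (in the tree: the named fact
`BorelSerre1973_finite_groupCohomology_congruenceSubgroup` for congruence subgroups) to the finite
generation of the cohomology of `ϖ`-adic lattices `V_𝒪` (e.g. `Sym^{k-2} 𝒪²`), as used in Hida
theory ([Hida1994AIF, §2–3]; `hidaControl_dominantOrdinaryPoint`).
[Brown1982CohomologyGroups, VIII.4–5 (finiteness conditions)], [Serre1971CohomologieGroupesDiscrets,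
§1.8 Remarque], [Matsumura1987, Thm. 8.4].

## References

* K. S. Brown, *Cohomology of Groups*, GTM 87 (1982), III.6 (long exact sequence), VIII.4–5
  (held). [Brown1982CohomologyGroups]
* J.-P. Serre, *Cohomologie des groupes discrets* (1971), §1.8. [Serre1971CohomologieGroupesDiscrets]
* H. Matsumura, *Commutative Ring Theory*, Thm. 8.4 (held). [Matsumura1987]
* H. Hida, Ann. Inst. Fourier 44 (1994), §2–3 (held). [Hida1994AIF]
-/

noncomputable section

open CategoryTheory groupCohomology
open scoped Pointwise

namespace Literature.Algebra.Homology

universe u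

variable {k : Type u} [CommRing k] {G : Type u} [Group G] (A : Rep k G) (ϖ : k)

/-- `ϖ V` is `G`-stable. [folklore] -/
theorem smul_top_le_comap (g : G) :
    (ϖ • ⊤ : Submodule k A.V) ≤ (ϖ • ⊤ : Submodule k A.V).comap (A.ρ g) := by
  intro v hv
  obtain ⟨w, -, rfl⟩ := (Submodule.mem_smul_pointwise_iff_exists _ _ _).1 hv
  rw [Submodule.mem_comap, map_smul]
  exact Submodule.smul_mem_pointwise_smul _ _ _ Submodule.mem_top

/-- `Hⁿ(G, ϖ · 𝟙_A)` is multiplication by `ϖ` on `Hⁿ(G, A)`. [folklore] -/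
theorem map_smul_id_apply (n : ℕ) (x : groupCohomology A n) :
    map (MonoidHom.id G) (ϖ • 𝟙 A) n x = ϖ • x := by
  induction x using groupCohomology_induction_on with
  | h z =>
    rw [π_map_apply, ← map_smul]
    congr 1
    refine iCocycles_injective A n ?_
    rw [iCocycles_cocyclesMap_id, map_smul]
    funext g
    rw [cochainsMap_id_f_apply]
    rfl

/-- `(ϖ · 𝟙_A) ≫ (A → A/ϖA) = 0`. [folklore] -/
theorem smul_id_comp_mkQ : (ϖ • 𝟙 A) ≫ A.mkQ (ϖ • ⊤) (smul_top_le_comap A ϖ) = 0 :=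
  Rep.hom_ext (Representation.IntertwiningMap.ext (LinearMap.ext fun v => by
    change Submodule.Quotient.mk (ϖ • v) = (0 : A.V ⧸ (ϖ • ⊤ : Submodule k A.V))
    exact (Submodule.Quotient.mk_eq_zero _).2
      (Submodule.smul_mem_pointwise_smul _ _ _ Submodule.mem_top)))

/-- **The short exact sequence `0 → A →(ϖ·) A → A/ϖA → 0`** for `ϖ`-torsion-free coefficients.
[cite: Brown1982CohomologyGroups, III.6] -/
theorem smul_shortExact (htf : ∀ v : A.V, ϖ • v = 0 → v = 0) :
    (ShortComplex.mk (ϖ • 𝟙 A) (A.mkQ (ϖ • ⊤) (smul_top_le_comap A ϖ))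
      (smul_id_comp_mkQ A ϖ)).ShortExact where
  exact := (forget₂ (Rep k G) (ModuleCat k)).reflects_exact_of_faithful _ <|
    (ShortComplex.moduleCat_exact_iff _).2 fun _ hv => by
      obtain ⟨w, -, hw⟩ := (Submodule.mem_smul_pointwise_iff_exists _ _ _).1
        ((Submodule.Quotient.mk_eq_zero _).1 hv)
      exact ⟨w, hw⟩
  mono_f := (Rep.mono_iff_injective _).2 fun v w h => by
    rw [← sub_eq_zero]
    refine htf _ ?_
    rw [smul_sub, sub_eq_zero]
    exact h
  epi_g := (Rep.epi_iff_surjective _).2 <| Submodule.mkQ_surjective _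

/-- **`ker (Hⁿ(G, A) → Hⁿ(G, A/ϖA)) ⊆ ϖ Hⁿ(G, A)`** (long exact sequence; in fact equality).
[cite: Brown1982CohomologyGroups, III.6 (long exact sequence)] -/
theorem ker_map_mkQ_le_smul_top (htf : ∀ v : A.V, ϖ • v = 0 → v = 0) (n : ℕ) :
    LinearMap.ker (map (MonoidHom.id G) (A.mkQ (ϖ • ⊤) (smul_top_le_comap A ϖ)) n).hom ≤
      ϖ • (⊤ : Submodule k (groupCohomology A n)) := by
  intro x hx
  have hex := (ShortComplex.moduleCat_exact_iff _).1
    (groupCohomology.mapShortComplex₂_exact (smul_shortExact A ϖ htf) n)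
  obtain ⟨y, hy⟩ := hex x hx
  have hy' : map (MonoidHom.id G) (ϖ • 𝟙 A) n y = x := hy
  rw [map_smul_id_apply] at hy'
  rw [← hy']
  exact Submodule.smul_mem_pointwise_smul _ _ _ Submodule.mem_top

/-- **`Hⁿ(G, A)/ϖ` is finite when `Hⁿ(G, A/ϖA)` is** (`ϖ`-torsion-free coefficients).
[cite: Brown1982CohomologyGroups, III.6 and VIII.5] -/
theorem finite_quotient_smul_top_of_finite (htf : ∀ v : A.V, ϖ • v = 0 → v = 0) (n : ℕ)
    (hfin : Finite (groupCohomology (A.quotient (ϖ • ⊤) (smul_top_le_comap A ϖ)) n)) :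
    Finite (groupCohomology A n ⧸ ϖ • (⊤ : Submodule k (groupCohomology A n))) := by
  set f := (map (MonoidHom.id G) (A.mkQ (ϖ • ⊤) (smul_top_le_comap A ϖ)) n).hom with hf
  haveI : Finite (LinearMap.range f) := inferInstance
  haveI : Finite (groupCohomology A n ⧸ LinearMap.ker f) := Finite.of_equiv _ f.quotKerEquivRange.symm.toEquiv
  exact Finite.of_surjective
    (Submodule.mapQ (LinearMap.ker f) (ϖ • ⊤) LinearMap.id (ker_map_mkQ_le_smul_top A ϖ htf n))
    fun y => by
      induction y using Submodule.Quotient.induction_on with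
      | H x => exact ⟨Submodule.Quotient.mk x, rfl⟩

/-- **`Hⁿ(G, A)` is a finitely generated `k`-module when `Hⁿ(G, A/ϖA)` is finite**, for
`ϖ`-adically complete `k` and `ϖ`-adically complete separated `ϖ`-torsion-free coefficients `V`
(no finiteness hypothesis on `G`). [cite: Serre1971CohomologieGroupesDiscrets, §1.8 Remarque]
[cite: Matsumura1987, Thm. 8.4] [cite: Brown1982CohomologyGroups, VIII.5] -/
theorem moduleFinite_of_finite_cohomology_quotient [IsPrecomplete (Ideal.span {ϖ}) k]
    [IsAdicComplete (Ideal.span {ϖ}) A.V] (htf : ∀ v : A.V, ϖ • v = 0 → v = 0) (n : ℕ)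
    (hfin : Finite (groupCohomology (A.quotient (ϖ • ⊤) (smul_top_le_comap A ϖ)) n)) :
    Module.Finite k (groupCohomology A n) :=
  haveI := finite_quotient_smul_top_of_finite A ϖ htf n hfin
  moduleFinite_of_isAdicComplete A ϖ n inferInstance

end Literature.Algebra.Homology
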